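import Summits.BirchSwinnertonDyer.BirchSwinnertonDyer.Theorems.ClassRecordThreeEulerHalvesAtThreeCartanTorusCubeCutPSCube
import Mathlib.RingTheory.IntegralDomain
import HarnessLib

/-!
# Crux 23422 line `cartan` v9, stub (F2a), PRINCIPAL-SERIES half of the torus-cube cut — the PHANTOM BOREL-FIXED VECTOR:
# `f₀ ∈ N_U X ∖ 3X` fixed modulo `3` by the whole upper Borel subgroup (`q ≡ 1 (mod 3)`)

Seat `bsd-stepL-tam3-p1` g21 (LINE OWNER of crux 23422; `--supports stmt-BirchSwinnertonDyer-23422 --as helper`). First file of the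
CONSTRUCTION OF THE MOD-3 LINE `X_M` (the hypotheses `hline`/`hsimple`/`hcyc`/`hND`/`hcube` of cartan-f2a g0's reductions `…PSLine*`).
For a `CartanTorusLattice q` with `q ≡ 1 (mod 3)` and the unipotent norm `N_U = Σ_y ρ(u y)` of `…PSUnipotent`:
* §1 `3X`-bookkeeping (`ThreeDvd x : ∃ y, x = 3·y`), the diagonal-trace criterion `not_threeDvd_of_trace` (an endomorphism all of whose
  values lie in `3X` has trace `≡ 0 (mod 3)`; here `three_dvd_trace_of_forall_threeDvd`);
* §2 `ρ(u y) ∘ N_U = N_U`; the cube triviality `ρ(diag(c,1)) ∘ N_U = N_U` (`c` a cube) and `tr N_U = 2q` are cartan-f2a g0's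
  `PS.rho_cube_comp_normU` ∕ `PS.trace_normU` (`…PSCube`, imported);
* §3 **the phantom vector** (`exists_phantom`): for a generator `a` of `𝔽_q^×` and `δ = diag(a,1)`, `(ρ(δ) − 1)³ N_U ≡ 0 (mod 3)`
  (`δ³` is a cube) and `N_U X ⊄ 3X` (`tr N_U = 2q`), so some `f₀ = N_U x₁ ∉ 3X` has `(ρ(δ) − 1) f₀ ∈ 3X`; consequently
  (`phantom_stab`) `ρ(g) f₀ − f₀ ∈ 3X` for every upper-triangular `g` (`g = z·δ^k·u(t)`, LEMMA Z).
HONEST FRAMING: finite-group averaging on one lattice; nothing about any curve, `L`-value or period; S-K1′ is NOT proved here; no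
summit statement, no route item and no registered stub is proved; BSD is proved for no curve. [folklore; background: cite: Bump1997, §4.1]
-/

namespace Summit.BirchSwinnertonDyer.BirchSwinnertonDyer.Theorems.CartanTorusCubeCut.PSMod

open Summit.BirchSwinnertonDyer.BirchSwinnertonDyer.Theorems.CartanDegree
open Summit.BirchSwinnertonDyer.BirchSwinnertonDyer.Theorems.CartanTorusCubeCut
open Summit.BirchSwinnertonDyer.BirchSwinnertonDyer.Theorems.CartanTorusCubeCut.PS

set_option linter.dupNamespace false
set_option autoImplicit false

open scoped Classical

/-! ### §1 `3X`-bookkeeping -/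

section Three
variable {d : ℕ}

/-- `x ∈ 3X`. -/
def ThreeDvd (x : Fin d → ℤ) : Prop := ∃ y : Fin d → ℤ, x = (3 : ℤ) • y

/-- `x ∈ 3X` iff every coordinate is divisible by `3`. -/
theorem threeDvd_iff (x : Fin d → ℤ) : ThreeDvd x ↔ ∀ i, (3 : ℤ) ∣ x i := by
  constructor
  · rintro ⟨y, rfl⟩ i
    exact ⟨y i, by simp⟩
  · intro h
    refine ⟨fun i => x i / 3, ?_⟩
    funext i
    simp only [Pi.smul_apply, smul_eq_mul]
    exact (Int.mul_ediv_cancel' (h i)).symm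

/-- `0 ∈ 3X`. -/
theorem threeDvd_zero : ThreeDvd (0 : Fin d → ℤ) := ⟨0, by simp⟩

/-- `3X` is closed under addition. -/
theorem ThreeDvd.add {x y : Fin d → ℤ} (hx : ThreeDvd x) (hy : ThreeDvd y) : ThreeDvd (x + y) := by
  obtain ⟨a, rfl⟩ := hx; obtain ⟨b, rfl⟩ := hy; exact ⟨a + b, by rw [smul_add]⟩

/-- `3X` is closed under negation. -/
theorem ThreeDvd.neg {x : Fin d → ℤ} (hx : ThreeDvd x) : ThreeDvd (-x) := by
  obtain ⟨a, rfl⟩ := hx; exact ⟨-a, by rw [smul_neg]⟩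

/-- `3X` is closed under subtraction. -/
theorem ThreeDvd.sub {x y : Fin d → ℤ} (hx : ThreeDvd x) (hy : ThreeDvd y) : ThreeDvd (x - y) := by
  rw [sub_eq_add_neg]; exact hx.add hy.neg

/-- `3X` is closed under integer multiples. -/
theorem ThreeDvd.zsmul {x : Fin d → ℤ} (n : ℤ) (hx : ThreeDvd x) : ThreeDvd (n • x) := by
  obtain ⟨a, rfl⟩ := hx; exact ⟨n • a, by rw [smul_comm]⟩

/-- `3X` is stable under every endomorphism. -/
theorem ThreeDvd.map (f : Module.End ℤ (Fin d → ℤ)) {x : Fin d → ℤ} (hx : ThreeDvd x) : ThreeDvd (f x) := by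
  obtain ⟨a, rfl⟩ := hx; exact ⟨f a, by rw [map_smul]⟩

/-- `3x ∈ 3X`. -/
theorem threeDvd_three_smul (x : Fin d → ℤ) : ThreeDvd ((3 : ℤ) • x) := ⟨x, rfl⟩

/-- `3X` is closed under finite sums. -/
theorem ThreeDvd.sum {ι : Type*} (s : Finset ι) {f : ι → Fin d → ℤ} (h : ∀ i ∈ s, ThreeDvd (f i)) :
    ThreeDvd (∑ i ∈ s, f i) := by
  induction s using Finset.induction_on with
  | empty => simpa using threeDvd_zero
  | insert a s ha ih =>
    rw [Finset.sum_insert ha]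
    exact (h a (Finset.mem_insert_self a s)).add (ih fun i hi => h i (Finset.mem_insert_of_mem hi))

/-- **diagonal-trace criterion**: if every value of `f` lies in `3X` then `3 ∣ tr f`. -/
theorem three_dvd_trace_of_forall_threeDvd (f : Module.End ℤ (Fin d → ℤ)) (h : ∀ x, ThreeDvd (f x)) :
    (3 : ℤ) ∣ LinearMap.trace ℤ _ f := by
  rw [LinearMap.trace_eq_matrix_trace ℤ (Pi.basisFun ℤ (Fin d)) f, Matrix.trace]
  apply Finset.dvd_sum
  intro i _
  rw [Matrix.diag_apply, LinearMap.toMatrix_apply, Pi.basisFun_repr, Pi.basisFun_apply]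
  exact (threeDvd_iff _).1 (h _) i

end Three

variable {q : ℕ} [Fact q.Prime]
variable (u : ZMod q → G q) (hu : ∀ y, ((u y : G q) : Mat q) = !![1, y; 0, 1])
include hu

/-! ### §2 The cubes of the mirabolic torus act trivially on `N_U X` -/

section Cubes
variable (𝓛 : CartanTorusLattice q)

/-- `ρ(u y) ∘ N_U = N_U`. -/
theorem rho_unipotent_mul_normU (y : ZMod q) :
    𝓛.ρ (u y) * (∑ y' : ZMod q, 𝓛.ρ (u y')) = ∑ y' : ZMod q, 𝓛.ρ (u y') := by
  rw [Finset.mul_sum]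
  simp_rw [← map_mul, unipotentParam_mul u hu]
  exact Fintype.sum_equiv (Equiv.addLeft y) _ _ (fun _ => rfl)

end Cubes

/-! ### §3 The phantom Borel-fixed vector -/

section Phantom
variable (𝓛 : CartanTorusLattice q)

omit [Fact q.Prime] hu in
/-- `(M − 1)³ = (M³ − 1) − 3·(M² − M)` in any ring. -/
theorem sub_one_pow_three {R : Type*} [Ring R] (M : R) :
    (M - 1) ^ 3 = (M ^ 3 - 1) - (3 : ℤ) • (M ^ 2 - M) := by
  rw [zsmul_eq_mul, Int.cast_ofNat]; noncomm_ring

/-- **the phantom vector**: for a generator `a` of `𝔽_q^×` (`q ≡ 1 (mod 3)`), some `f₀ = N_U x₁ ∉ 3X` has `(ρ(diag(a,1)) − 1) f₀ ∈ 3X`. -/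
theorem exists_phantom (h1 : q % 3 = 1) (a : (ZMod q)ˣ) :
    ∃ f₀ : Fin 𝓛.d → ℤ, (∃ x₁, f₀ = (∑ y : ZMod q, 𝓛.ρ (u y)) x₁) ∧ ¬ ThreeDvd f₀ ∧
      ThreeDvd (𝓛.ρ (diagGL ![a, 1]) f₀ - f₀) := by
  set NU : Module.End ℤ (Fin 𝓛.d → ℤ) := ∑ y : ZMod q, 𝓛.ρ (u y) with hNU
  set M : Module.End ℤ (Fin 𝓛.d → ℤ) := 𝓛.ρ (diagGL ![a, 1]) with hM
  -- `a³` is a cube, so `M³ N_U = N_U`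
  have hq : q.Prime := Fact.out
  have hcube : ((a ^ 3 : (ZMod q)ˣ) : ZMod q) ^ ((q - 1) / 3) = 1 := by
    rw [Units.val_pow_eq_pow_val, ← pow_mul]
    have e : 3 * ((q - 1) / 3) = q - 1 := three_mul_k h1
    rw [e, ← Units.val_pow_eq_pow_val, ZMod.units_pow_card_sub_one_eq_one, Units.val_one]
  have hM3 : M ^ 3 * NU = NU := by
    rw [hM, ← map_pow]
    have e : (diagGL ![a, 1] : G q) ^ 3 = diagGL ![a ^ 3, 1] := by
      rw [pow_succ, pow_two, diagGL_mirabolic_mul, diagGL_mirabolic_mul, ← pow_two, ← pow_succ]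
    rw [e]
    exact PS.rho_cube_comp_normU u hu 𝓛 h1 hcube
  have hMN : M * NU = NU * M := rho_diagGL_comp_normU u hu 𝓛 a
  -- `(M − 1)³ N_U x ∈ 3X`
  have h3 : ∀ x, ThreeDvd ((((M - 1) ^ 3 * NU : Module.End ℤ (Fin 𝓛.d → ℤ))) x) := by
    intro x
    refine ⟨-((M ^ 2 - M) (NU x)), ?_⟩
    have e : ((M - 1) ^ 3 * NU : Module.End ℤ (Fin 𝓛.d → ℤ)) = -((3 : ℤ) • ((M ^ 2 - M) * NU)) := by
      rw [sub_one_pow_three, sub_mul, sub_mul, one_mul, hM3, sub_self, zero_sub, smul_mul_assoc]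
    rw [e, LinearMap.neg_apply, LinearMap.smul_apply, Module.End.mul_apply, smul_neg]
  -- `N_U x₀ ∉ 3X` for some `x₀`
  obtain ⟨x₀, hx₀⟩ : ∃ x₀, ¬ ThreeDvd (NU x₀) := by
    by_contra hall
    push Not at hall
    have h3tr := three_dvd_trace_of_forall_threeDvd NU hall
    rw [hNU, PS.trace_normU u hu 𝓛 h1] at h3tr
    have : (3 : ℤ) ∣ 2 * (q : ℤ) := h3tr
    have h3q : (3 : ℤ) ∣ (q : ℤ) := (Int.prime_three.dvd_mul.1 this).resolve_left (by norm_num)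
    have : 3 ∣ q := by exact_mod_cast h3q
    omega
  -- the selection along `v₀, (M−1)v₀, (M−1)²v₀`
  have hcommk : ∀ k : ℕ, (M - 1) ^ k * NU = NU * (M - 1) ^ k := fun k =>
    ((Commute.sub_left (show Commute M NU from hMN) (Commute.one_left NU)).pow_left k).eq
  have himage : ∀ k : ℕ, ∃ x₁, ((M - 1) ^ k) (NU x₀) = NU x₁ := fun k =>
    ⟨((M - 1) ^ k) x₀, by rw [← Module.End.mul_apply, hcommk, Module.End.mul_apply]⟩
  have hstep : ∀ k : ℕ, M (((M - 1) ^ k) (NU x₀)) - ((M - 1) ^ k) (NU x₀) = ((M - 1) ^ (k + 1)) (NU x₀) := by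
    intro k
    rw [pow_succ', Module.End.mul_apply, LinearMap.sub_apply, Module.End.one_apply]
  by_cases hv1 : ThreeDvd ((((M - 1) ^ 1 : Module.End ℤ (Fin 𝓛.d → ℤ))) (NU x₀))
  · refine ⟨NU x₀, ⟨x₀, rfl⟩, hx₀, ?_⟩
    have := hstep 0
    rw [pow_zero, Module.End.one_apply] at this
    rw [this]; exact hv1
  by_cases hv2 : ThreeDvd ((((M - 1) ^ 2 : Module.End ℤ (Fin 𝓛.d → ℤ))) (NU x₀))
  · exact ⟨(((M - 1) ^ 1 : Module.End ℤ (Fin 𝓛.d → ℤ))) (NU x₀), himage 1, hv1, by rw [hstep 1]; exact hv2⟩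
  · refine ⟨(((M - 1) ^ 2 : Module.End ℤ (Fin 𝓛.d → ℤ))) (NU x₀), himage 2, hv2, ?_⟩
    rw [hstep 2]
    have := h3 x₀
    rwa [Module.End.mul_apply] at this

/-- `ρ(u y) f₀ = f₀` for `f₀ ∈ N_U X`. -/
theorem rho_unipotent_apply_normU (y : ZMod q) (x : Fin 𝓛.d → ℤ) :
    𝓛.ρ (u y) ((∑ y' : ZMod q, 𝓛.ρ (u y')) x) = (∑ y' : ZMod q, 𝓛.ρ (u y')) x := by
  rw [← Module.End.mul_apply, rho_unipotent_mul_normU u hu]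

omit [Fact q.Prime] hu in
/-- iterating a congruence: `(M − 1) f ∈ 3X ⇒ (M^k − 1) f ∈ 3X`. -/
theorem threeDvd_pow_sub (M : Module.End ℤ (Fin 𝓛.d → ℤ)) {f : Fin 𝓛.d → ℤ} (h : ThreeDvd (M f - f)) (k : ℕ) :
    ThreeDvd ((M ^ k) f - f) := by
  induction k with
  | zero => rw [pow_zero, Module.End.one_apply, sub_self]; exact threeDvd_zero
  | succ k ih =>
    have e : (M ^ (k + 1)) f - f = M ((M ^ k) f - f) + (M f - f) := by
      rw [pow_succ', Module.End.mul_apply, map_sub]; abel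
    rw [e]
    exact (ih.map M).add h

/-- **an upper-triangular element is `z·δ^k·u(t)`** for a generator `a` of `𝔽_q^×` (`δ = diag(a,1)`, `z` scalar). -/
theorem upper_triangular_factor (a : (ZMod q)ˣ) (ha : ∀ b : (ZMod q)ˣ, b ∈ Submonoid.powers a) {g : G q}
    (hg : (g : Mat q) 1 0 = 0) :
    ∃ (z : (ZMod q)ˣ) (k : ℕ) (t : ZMod q), g = diagGL ![z, z] * (diagGL ![a, 1] ^ k * u t) := by
  -- entries
  have hdet : (g : Mat q).det = (g : Mat q) 0 0 * (g : Mat q) 1 1 := by rw [Matrix.det_fin_two, hg]; ring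
  have hunit : IsUnit (g : Mat q).det := by rw [← Matrix.isUnit_iff_isUnit_det]; exact Units.isUnit g
  have h00 : (g : Mat q) 0 0 ≠ 0 := fun h => hunit.ne_zero (by rw [hdet, h, zero_mul])
  have h11 : (g : Mat q) 1 1 ≠ 0 := fun h => hunit.ne_zero (by rw [hdet, h, mul_zero])
  have hpow : ∀ n : ℕ, (diagGL ![a, 1] : G q) ^ n = diagGL ![a ^ n, 1] := by
    intro n
    induction n with
    | zero => apply Units.ext; rw [pow_zero, diagGL_coe]; ext i j; fin_cases i <;> fin_cases j <;> simp
    | succ n ih => rw [pow_succ, ih, diagGL_mirabolic_mul, ← pow_succ]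
  set z : (ZMod q)ˣ := Units.mk0 _ h11 with hz
  set b : (ZMod q)ˣ := Units.mk0 _ h00 * z⁻¹ with hb
  obtain ⟨k, hk⟩ := (Submonoid.mem_powers_iff _ _).1 (ha b)
  set t : ZMod q := (g : Mat q) 0 1 * ((g : Mat q) 0 0)⁻¹ with ht
  refine ⟨z, k, t, ?_⟩
  rw [hpow, hk]
  apply Units.ext
  rw [Units.val_mul, diagGL_coe, diagGL_mul_unipotentParam_coe u hu]
  have e00 : (g : Mat q) 0 0 = (g : Mat q) 1 1 * ((g : Mat q) 0 0 * ((g : Mat q) 1 1)⁻¹) := by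
    field_simp
  have e01 : (g : Mat q) 0 1 = (g : Mat q) 1 1 * ((g : Mat q) 0 0 * ((g : Mat q) 1 1)⁻¹ *
      ((g : Mat q) 0 1 * ((g : Mat q) 0 0)⁻¹)) := by
    field_simp
  ext i j
  fin_cases i <;> fin_cases j
  · simpa [Matrix.mul_apply, Fin.sum_univ_two, hb, hz, ht] using e00
  · simpa [Matrix.mul_apply, Fin.sum_univ_two, hb, hz, ht] using e01
  · simp [Matrix.mul_apply, Fin.sum_univ_two, hg]
  · simp [Matrix.mul_apply, Fin.sum_univ_two, hz]

/-- **the phantom vector is Borel-fixed mod 3**: for `f₀ = N_U x₁` with `(ρ(δ) − 1)f₀ ∈ 3X` and `g` upper triangular,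
`ρ(g) f₀ − f₀ ∈ 3X`. -/
theorem phantom_stab (a : (ZMod q)ˣ) (ha : ∀ b : (ZMod q)ˣ, b ∈ Submonoid.powers a) {f₀ : Fin 𝓛.d → ℤ}
    (hfU : ∃ x₁, f₀ = (∑ y : ZMod q, 𝓛.ρ (u y)) x₁) (hfδ : ThreeDvd (𝓛.ρ (diagGL ![a, 1]) f₀ - f₀))
    {g : G q} (hg : (g : Mat q) 1 0 = 0) : ThreeDvd (𝓛.ρ g f₀ - f₀) := by
  obtain ⟨z, k, t, rfl⟩ := upper_triangular_factor u hu a ha hg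
  obtain ⟨x₁, rfl⟩ := hfU
  rw [map_mul, map_mul, rho_eq_one_of_isScalar 𝓛 (isScalarMat_diagGL_const z), one_mul, Module.End.mul_apply,
    rho_unipotent_apply_normU u hu, map_pow]
  exact threeDvd_pow_sub 𝓛 _ hfδ k

end Phantom

end Summit.BirchSwinnertonDyer.BirchSwinnertonDyer.Theorems.CartanTorusCubeCut.PSMod
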